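import Literature.AnabelianGeometry.EtaleTheta.Discharge.Sec5PsiTransportDataOfBiKummerData
import Literature.AnabelianGeometry.EtaleTheta.Discharge.Sec5SectionPairsOfModel

/-!
# [EtTh] §5 at the assembled data with `s^trv_N` PRODUCED: the transports of Thm. 5.10 (ii) with σ a restricted base-Frobenius section (pp. 330–331, 334 / PDF pp. 104–105, 108)

Mochizuki, *The étale theta function …*, Publ. RIMS **45** (2009), §5 p.330–331 (PDF pp.104–105): "`s^trv_N : Aut_D(A_N^bs) → Aut_C(A_N)`
… the group homomorphism … arising from a base-Frobenius pair of `A_N` [cf. Proposition 5.1; Theorem 3.7, (i); [FrdI], Proposition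
5.6]"; proof of Thm. 5.10 (ii) p.334 (PDF p.108) [cite: MochizukiEtTh2009, §5 p.330–331 (PDF pp.104–105)]; [FrdI] Prop. 5.6 p.105.

PROOF-ONLY (no definitions, no new named facts).  abc-iut cell, layer L2, abc-iut-L2-lead RULINGS #13-addendum (R149) «the section-pair
input of hstrv as a THEOREM at ofBiKummerData» (prover abc-iut-w5-d245): in abc-iut-L2-t4's assembled §5 data `ofBiKummerData` the
section `s^trv_N := σ` is a free parameter; here it is PRODUCED print-faithfully — `σ :=` the restriction to `A_N` of a base-Frobenius
pair `(P, F)` of the model tempered Frobenioid through `A_N` (abc-iut-L1: `ModelFrobenioid.exists_isBaseFrobeniusPair_obj`,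
`PreFrobenioid.prop56_exists`; packaged as `ModelFrobenioid.exists_sectionPair_of_hypotheses`, p428959) — so that the section-pair
input `(φ, hφ, hc)` of `exists_unit_transports_ofBiKummerData_model` (p428815) is a THEOREM for that `σ`.  The divisor-invariance
clauses `hdivc`/`hdivp` of `ofBiKummerData` ("`Div(s^⊓_N)` descends … to `Φ(A_⊚)`", p.330 (PDF p.104)) depend on `σ` only through
`Base(σ g) = g`; for a SECTION they are the σ-free Galois-invariance of `Div(s^⊓_N)`, `Div(s^⊔_N)` under `Aut_D(A_N^bs)`
(`hdivc_of_section`, `hdivp_of_section`: `Div(σ(g) ≫ s) = g^* Div(s)` since automorphisms have trivial divisor over a divisorial `Φ`).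

RESULT `exists_section_unit_transports_ofBiKummerData_model`: for the model hypotheses (base of FSM-type, slim, `Φ` non-dilating, `C`
not group-like), `A_N` Frobenius-trivial, the σ-free Galois-invariance of the root divisors, a self-equivalence `Ψ` with identifications
`α, β`, and Prop. 5.3 (vi) at `A_N` (`e = 1` form): ∃ section `σ` (with its `hσ`, `hdivc`, `hdivp`), ∃ base shadow `θ`, ∃ UNIT `e`,
∃ `D_c, D_p` such that AT THE DATA `ofBiKummerData … σ … hdivc hdivp` the four transport binders `hT ∧ hT′ ∧ hu ∧ hstrv` of
`cyclotomicRigidityPreserved_ofBiKummerData` hold with ONE `e` — σ PRODUCED ∧ θ PRODUCED, as asked for K4 consolidation v3.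
Nothing asserts that the §5 data exist for an actual curve; no side is taken on [IUTchIII] Cor. 3.12.
-/

noncomputable section

open CategoryTheory Opposite

namespace Literature.AnabelianGeometry.EtaleTheta

open Literature.AlgebraicGeometry.Frobenioids

namespace ThetaFrobenioid

universe u₀ v₀ u v w

variable {K : Type u₀} [Field K]
  {X : SemiGraphs.TemperedArithmeticGroup.{u₀} K} {D₀ : Type u₀} [Category.{v₀} D₀]
  {V : FrdIMonoidStub.{w}} {T₀ : RealifiedDivisorMonoids (D₀ := D₀) V} {D : Type u} [Category.{v} D]
  {VD : FrdICatStub.{u, v, w} D} {S : BiKummerSetting X T₀ D VD}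
  {pullFrac : ∀ {A A' : S.C} (_ : A' ⟶ A), S.biratUnits A → S.biratUnits A'}
  {lv N : ℕ+} {T : ThetaEnvData.{max v w} N} {θr : S.biratUnits S.Aodot} {Bl : S.C}
  {Pl : S.FractionPair θr Bl} {Rl : S.NthRoot θr Pl lv pullFrac}
  (h : ModelFrobenioid.Hypotheses S.tf.divisorMonoid S.tf.ratFnFunctor)
  (toB : ∀ A : S.C, S.biratUnits A →* S.tf.biratUnitsModel A) (Q : FrobenioidTheta.ThetaSubquotientStub.{w} D)
  (odd_l : Odd (lv : ℕ)) (R : S.NthRoot Rl.root Rl.pair N pullFrac) (ιX : T.PiX ≃ₜ* X.Pi)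
  (hopen : IsOpen ((S.galoisSurj R.AN.base R.αData.isGalois).ker : Set X.Pi))
  (K' : Type w) [Field K'] (constEmb : K'ˣ →* S.tf.biratUnitsModel R.BN)
  (constEmb_injective : Function.Injective constEmb)

include h in
/-- For a SECTION `σ` of `Aut_C(A_N) → Aut_D(A_N^bs)`, the divisor clause `hdivc` of `ofBiKummerData` ("`Div(s^⊓_N)` descends", p.330
(PDF p.104)) is the σ-free Galois-invariance of `Div(s^⊓_N)`: `Div(σ(g′) ≫ s^⊓_N) = (g′)^* Div(s^⊓_N) · Div(σ g′)^{1} = (g′)^* Div(s^⊓_N)`,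
automorphisms having trivial divisor over a divisorial `Φ` ([FrdI] Rem. 1.1.1). [cite: MochizukiEtTh2009, §5 p.330 (PDF p.104)] -/
theorem hdivc_of_section (σ : Aut R.AN.base →* Aut R.AN) (hσ : ∀ g : Aut R.AN.base, ModelFrobenioid.baseMap (σ g).hom = g.hom)
    (hdivc₀ : ∀ g' : Aut R.AN.base,
      (S.tf.divisorMonoid.map g'.hom.op).hom (ModelFrobenioid.div R.pair.num) = ModelFrobenioid.div R.pair.num) :
    ∀ g : Aut R.BN.base,
      ModelFrobenioid.div ((σ ((BiKummerSetting.NthRoot.baseIso S R).conjAut.symm g)).hom ≫ R.pair.num) =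
        ModelFrobenioid.div R.pair.num := by
  intro g
  set g' : Aut R.AN.base := (BiKummerSetting.NthRoot.baseIso S R).conjAut.symm g with hg'
  have hiso : ModelFrobenioid.div (σ g').hom = 1 := by
    haveI : IsIso (σ g').hom := (σ g').isIso_hom
    exact ModelFrobenioid.div_eq_one_of_isIso (DivB := S.tf.divBNatTrans) h.isDivisorial _
  rw [ModelFrobenioid.div_comp, hiso, one_pow, mul_one, hσ]
  exact hdivc₀ _

include h in
/-- The same for `hdivp` ("`Div(s^⊔_N)`", the theta-trivialisation side) at the elements of `Π^tp_Ÿ̲`: σ-free Galois-invariance of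
`Div(s^⊔_N)` under the images `ρ_{A_N}(ι_X y)`. [cite: MochizukiEtTh2009, §5 p.330 (PDF p.104)] -/
theorem hdivp_of_section (σ : Aut R.AN.base →* Aut R.AN) (hσ : ∀ g : Aut R.AN.base, ModelFrobenioid.baseMap (σ g).hom = g.hom)
    (hdivp₀ : ∀ y : T.PiYdd,
      (S.tf.divisorMonoid.map (S.galoisSurj R.AN.base R.αData.isGalois (ιX y.1)).hom.op).hom (ModelFrobenioid.div R.pair.den) =
        ModelFrobenioid.div R.pair.den) :
    ∀ y : T.PiYdd,
      ModelFrobenioid.div ((σ (S.galoisSurj R.AN.base R.αData.isGalois (ιX y.1))).hom ≫ R.pair.den) = ModelFrobenioid.div R.pair.den := by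
  intro y
  set g' : Aut R.AN.base := S.galoisSurj R.AN.base R.αData.isGalois (ιX y.1) with hg'
  have hiso : ModelFrobenioid.div (σ g').hom = 1 := by
    haveI : IsIso (σ g').hom := (σ g').isIso_hom
    exact ModelFrobenioid.div_eq_one_of_isIso (DivB := S.tf.divBNatTrans) h.isDivisorial _
  rw [ModelFrobenioid.div_comp, hiso, one_pow, mul_one, hσ]
  exact hdivp₀ _

/-- **Thm. 5.10 (ii), first sentences, at the assembled §5 data with `s^trv_N` AND the base shadow PRODUCED.**  For the model
tempered Frobenioid of the §4 setting (base of FSM-type, slim, `Φ` non-dilating, `C` not of group-like type — [EtTh] Thm. 3.7 (i)(ii)),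
`A_N` Frobenius-trivial, the σ-free Galois-invariance of `Div(s^⊓_N)`, `Div(s^⊔_N)`, a self-equivalence `Ψ` with `α : Ψ(A_N) ⥲ A_N`,
`β : Ψ(B_N) ⥲ B_N` and Prop. 5.3 (vi) at `A_N` (`Div(α⁻¹ ≫ Ψ(s) ≫ β) = Div(s)` for `s = s^⊓_N, s^⊔_N`): there is a SECTION `σ = s^trv_N`
arising from a base-Frobenius pair of `A_N` ([FrdI] Prop. 5.6 via abc-iut-L1's base-section through `A_N`), with its `hdivc`/`hdivp`, a
base shadow `θ` of `Ψ` ([FrdI] Thm. 3.4 (v) `Ψ^bs`), ONE unit `e ∈ O^×(A_N)` and `D_c, D_p` such that at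
`ofBiKummerData … σ … hdivc hdivp` the binders `hT`, `hT′`, `hu` (for `β ≫ D_c⁻¹`) and `hstrv` (for `θ_B`) of
`cyclotomicRigidityPreserved_ofBiKummerData` hold.  [cite: MochizukiEtTh2009, Thm 5.10 (ii) p.334 (PDF p.108)] -/
theorem exists_section_unit_transports_ofBiKummerData_model (hD : IsOfFSMType D) (hslim : IsSlim D)
    (hnd : IsNonDilatingOn S.tf.divisorMonoid)
    (hN : ∃ A : S.C, ¬ (PreFrobenioidData.ofModel S.tf.divisorMonoid S.tf.ratFnFunctor S.tf.divBNatTrans).IsGroupLikeObj A)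
    (hAN : PreFrobenioid.IsFrobeniusTrivial S.F R.AN)
    (hdivc₀ : ∀ g' : Aut R.AN.base,
      (S.tf.divisorMonoid.map g'.hom.op).hom (ModelFrobenioid.div R.pair.num) = ModelFrobenioid.div R.pair.num)
    (hdivp₀ : ∀ y : T.PiYdd,
      (S.tf.divisorMonoid.map (S.galoisSurj R.AN.base R.αData.isGalois (ιX y.1)).hom.op).hom (ModelFrobenioid.div R.pair.den) =
        ModelFrobenioid.div R.pair.den)
    (Ψ : S.C ≌ S.C) (α : Ψ.functor.obj R.AN ≅ R.AN) (β : Ψ.functor.obj R.BN ≅ R.BN)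
    (hdivcap₁ : (PreFrobenioidData.ofModel S.tf.divisorMonoid S.tf.ratFnFunctor S.tf.divBNatTrans).div
        (α.inv ≫ Ψ.functor.map R.pair.num ≫ β.hom) =
      (PreFrobenioidData.ofModel S.tf.divisorMonoid S.tf.ratFnFunctor S.tf.divBNatTrans).div R.pair.num)
    (hdivcup₁ : (PreFrobenioidData.ofModel S.tf.divisorMonoid S.tf.ratFnFunctor S.tf.divBNatTrans).div
        (α.inv ≫ Ψ.functor.map R.pair.den ≫ β.hom) =
      (PreFrobenioidData.ofModel S.tf.divisorMonoid S.tf.ratFnFunctor S.tf.divBNatTrans).div R.pair.den) :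
    ∃ (σ : Aut R.AN.base →* Aut R.AN) (_ : ∀ g : Aut R.AN.base, ModelFrobenioid.baseMap (σ g).hom = g.hom)
      (hdivc : ∀ g : Aut R.BN.base,
        ModelFrobenioid.div ((σ ((BiKummerSetting.NthRoot.baseIso S R).conjAut.symm g)).hom ≫ R.pair.num) =
          ModelFrobenioid.div R.pair.num)
      (hdivp : ∀ y : T.PiYdd,
        ModelFrobenioid.div ((σ (S.galoisSurj R.AN.base R.αData.isGalois (ιX y.1))).hom ≫ R.pair.den) =
          ModelFrobenioid.div R.pair.den)
      (θ : Aut R.AN.base ≃* Aut R.AN.base),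
      ∃ e ∈ (ofBiKummerData h toB Q odd_l R ιX hopen σ K' constEmb constEmb_injective hdivc hdivp).units R.AN,
        ∃ Dc Dp : Aut R.BN,
          α.inv ≫ Ψ.functor.map R.pair.num ≫ (β ≪≫ Dc.symm).hom = e.hom ≫ R.pair.num ≫ (1 : Aut R.BN).hom ∧
          α.inv ≫ Ψ.functor.map R.pair.den ≫ (β ≪≫ Dc.symm).hom = e.hom ≫ R.pair.den ≫ Dp.hom ∧
          Dp ∈ (ofBiKummerData h toB Q odd_l R ιX hopen σ K' constEmb constEmb_injective hdivc hdivp).units R.BN ∧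
          (ofBiKummerData h toB Q odd_l R ιX hopen σ K' constEmb constEmb_injective hdivc hdivp).StrvTransport Ψ α e
            (((ofBiKummerData h toB Q odd_l R ιX hopen σ K' constEmb constEmb_injective hdivc hdivp).autBaseIsoAB.symm.trans
              θ).trans (ofBiKummerData h toB Q odd_l R ιX hopen σ K' constEmb constEmb_injective hdivc hdivp).autBaseIsoAB) := by
  -- `σ := s^trv_N` = the restriction of a base-Frobenius pair through the Frobenius-trivial `A_N` ([FrdI] Prop. 5.6)
  obtain ⟨σ, φ, hσF, hφ, hc⟩ :=
    ModelFrobenioid.exists_sectionPair_of_hypotheses (DivB := S.tf.divBNatTrans) h R.AN hAN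
  have hσ : ∀ g : Aut R.AN.base, ModelFrobenioid.baseMap (σ g).hom = g.hom := fun g => congrArg Iso.hom (hσF g)
  have hdivc := hdivc_of_section h R σ hσ hdivc₀
  have hdivp := hdivp_of_section h R ιX σ hσ hdivp₀
  obtain ⟨θ, e, he, Dc, Dp, hT, hT', hu, hstrv⟩ :=
    exists_unit_transports_ofBiKummerData_model h toB Q odd_l R ιX hopen σ K' constEmb constEmb_injective hdivc hdivp hD hslim
      hnd hN hσ φ hφ hc Ψ α β hdivcap₁ hdivcup₁
  exact ⟨σ, hσ, hdivc, hdivp, θ, e, he, Dc, Dp, hT, hT', hu, hstrv⟩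

end ThetaFrobenioid

end Literature.AnabelianGeometry.EtaleTheta

end
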